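import Literature.ModelTheory.ExponentialFields.RealExpField
import Literature.ModelTheory.ExponentialFields.OrderedFieldModels
import Literature.ModelTheory.ExponentialFields.DecidableTheoryProofs
import Literature.ModelTheory.ExponentialFields.MacintyreWilkie
import Literature.ModelTheory.ExponentialFields.OrderedExpFieldModels
import Literature.ModelTheory.ExponentialFields.RealClosedTransfer
import Literature.ModelTheory.ProofTheory.GodelCoding
import HarnessLib

/-!
# Tarski's theorem, decidability half: `RCF` is computably axiomatized and complete, hence decidable

Proof file for the named fact `Literature.ModelTheory.ExponentialFields.tarski_isDecidable`
(**periods.S29**, `RealExpField.lean`: the theory `RCF` of real closed ordered fields is decidable;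
Tarski 1951, Marker 2002 Cor. 3.3.16). Marker's proof of Cor. 3.3.16 is: `RCF` is complete
(Cor. 3.3.16(i), from quantifier elimination Thm. 3.3.15) and recursively axiomatized, hence
decidable by Lemma 2.2.8 (Janiczak's theorem: a complete theory with a recursive set of axioms in
a recursive language is decidable). Janiczak's theorem is proved in the tree
(`FirstOrder.Language.Theory.isDecidable_of_isComplete_of_isComputablyAxiomatizable_holds`,
`DecidableTheoryProofs.lean`, on top of the completeness theorem of
`Literature/ModelTheory/ProofTheory/`), and `Language.orderedRing` is recursively presented
(`Language.orderedRing.isRecursivelyPresented`, `DecidableTheory.lean`); completeness of `RCF`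
(the named fact `tarski_isComplete`) is proved in `RealClosedTransfer.lean`
(`Literature.ModelTheory.ExponentialFields.tarski_isComplete_holds`: Tarski's transfer principle,
by Cohen–Hörmander elimination carried out uniformly in two real closed fields). This file supplies
the remaining ingredient, the reduction, and the discharge:

* `Literature.ModelTheory.ExponentialFields.RCF_isComputablyAxiomatizable` (proved): `Theory.RCF`
  has a *recursive* set of axioms with the same consequences;
* `Literature.ModelTheory.ExponentialFields.RCF_isRE` (proved): the consequences of `RCF` are
  recursively enumerable;
* `Literature.ModelTheory.ExponentialFields.tarski_isDecidable_of_isComplete` (proved):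
  `tarski_isComplete → tarski_isDecidable`, i.e. the named fact `tarski_isDecidable` follows from
  the named fact `tarski_isComplete` (completeness of `RCF`, Marker Cor. 3.3.16(i));
* `Literature.ModelTheory.ExponentialFields.tarski_isDecidable_holds` (proved): **the discharge of
  the named fact `tarski_isDecidable`**, `tarski_isDecidable_of_isComplete` fed with
  `tarski_isComplete_holds`; and its corollary
  `Literature.ModelTheory.ExponentialFields.isDecidable_completeTheory_real` (proved): the
  complete theory `Th(ℝ; +, *, -, 0, 1, ≤)` of the ordered field of real numbers is decidable
  (Tarski 1951: "a decision method for elementary algebra");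
* `Literature.ModelTheory.ExponentialFields.tarski_isComplete_of_hasQE`,
  `Literature.ModelTheory.ExponentialFields.tarski_isDecidable_of_hasQE` (proved): completeness,
  hence decidability, also follow from the named fact `tarski_hasQE` (quantifier elimination
  for `RCF`, Marker Thm. 3.3.15; proved in `RealExpFieldProofs.lean` as `tarski_hasQE_holds`),
  because quantifier-free sentences are decided in `ℤ` (`realize_iff_int_of_isQF`) — Marker's
  own route to Cor. 3.3.16(i).

## Why `RCF` is not literally shown recursive

`Theory.RCF = Theory.orderedField ∪ range oddDegreeHasRootSentence ∪ {nonnegHasSqrtSentence}`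
(`RealClosedFieldTheory.lean`), and `oddDegreeHasRootSentence n` is Mathlib's
`FirstOrder.Field.genericMonicPolyHasRoot (2 n + 1)` transported to `Language.orderedRing`, whose
term is `Ring.termOfFreeCommRing (genericMonicPoly _)` — *defined by `Classical.choose`*
(`Mathlib/ModelTheory/Algebra/Ring/FreeCommRing.lean`). Its Gödel number is therefore not
determined by anything provable, and `Theory.RCF.IsRecursive` (membership in *this* axiom list is
decidable) is out of reach in principle. The notion consumed by Janiczak's theorem is
`Theory.IsComputablyAxiomatizable` (*some* recursive axiom set with the same consequences), and we
exhibit one: `Theory.RCF'`, in which the odd-degree axioms are replaced by the explicit sentences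
`MonicPolyHasRoot.sentence (2 n + 1)` — "`∀ a₀ … a_{d-1} ∃ x, x^d + Σ aᵢ xⁱ = 0`" written with an
explicit term (`MonicPolyHasRoot.genericMonicPolyTerm`, the term Mathlib's `genericMonicPoly`
denotes).

## Proof

* *Same consequences* (`models_RCF'_iff`): both families of sentences say, in every model of
  `Theory.orderedField`, that every monic polynomial of degree `2 n + 1` has a root
  (`MonicPolyHasRoot.realize_sentence`, Mathlib's `Field.realize_genericMonicPolyHasRoot`); this
  uses that an *abstract* model of `Theory.orderedField` is a field
  (`OrderedFieldModel.Dom`, `OrderedFieldModels.lean`).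
* *Recursiveness* (`RCF'_isRecursive`): the finite part is recursive
  (`Theory.IsRecursive.of_finite`); the Gödel number of `MonicPolyHasRoot.sentence d` is computed
  letter by letter (`ProofTheory/GodelCoding.lean`: `termLetters_func`, `formulaLetters_all`, …) as
  a primitive recursive function `d ↦ encode (lettersSentence d)` dominating `d`, so membership in its
  range is a bounded search (`PrimrecRel.exists_lt`).

## References

* A. Tarski, *A decision method for elementary algebra and geometry*, 2nd ed., Univ. of California
  Press (1951).
* D. Marker, *Model Theory: An Introduction*, Springer GTM 217 (2002), Lemma 2.2.8, §3.3,
  Cor. 3.3.16.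
* A. Janiczak, *A remark concerning decidability of complete theories*, JSL 15 (1950) 277–279.
-/

noncomputable section

open FirstOrder FirstOrder.Language FirstOrder.Language.Structure Polynomial Encodable

universe w

namespace Literature.ModelTheory.ExponentialFields

/-! ### The explicit odd-degree axioms -/

namespace MonicPolyHasRoot

variable {k : ℕ}

/-- Iterated power `t ^ j = (⋯((1 * t) * t)⋯) * t` of a term of `Language.orderedRing`. [folklore] -/
def powT (t : Language.orderedRing.Term (Empty ⊕ Fin k)) : ℕ → Language.orderedRing.Term (Empty ⊕ Fin k)
  | 0 => 1
  | j + 1 => powT t j * t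

/-- Sum `t₁ + (t₂ + (⋯ + 0))` of a list of terms of `Language.orderedRing`. [folklore] -/
def sumT : List (Language.orderedRing.Term (Empty ⊕ Fin k)) → Language.orderedRing.Term (Empty ⊕ Fin k)
  | [] => 0
  | t :: ts => t + sumT ts

/-- The *generic monic polynomial of degree `n`* as an explicit term of `Language.orderedRing` in the
bound variables `&0, …, &n`: `&n ^ n + Σ_{i < n} &i * &n ^ i` (coefficients `&0, …, &(n-1)`,
indeterminate `&n`); the term denoted by Mathlib's `FirstOrder.Field.genericMonicPoly n`
(`realize_genericMonicPolyTerm`). [folklore] -/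
def genericMonicPolyTerm (n : ℕ) : Language.orderedRing.Term (Empty ⊕ Fin (n + 1)) :=
  powT (Term.var (Sum.inr (Fin.last n))) n +
    sumT (List.ofFn fun i : Fin n =>
      Term.var (Sum.inr i.castSucc) * powT (Term.var (Sum.inr (Fin.last n))) i)

/-- The sentence "every monic polynomial of degree `n` has a root":
`∀ a₀ … a_{n-1} ∃ x, x ^ n + Σ_{i<n} aᵢ x ^ i = 0`, an explicit variant of Mathlib's
`FirstOrder.Field.genericMonicPolyHasRoot n` in the language of ordered rings (Marker 2002, §3.3,
axioms of `RCF`). [cite: Marker2002, §3.3] -/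
def sentence (n : ℕ) : Language.orderedRing.Sentence :=
  (∃' (genericMonicPolyTerm n =' 0)).alls

section Semantics

variable {R : Type*} [CommRing R] [LE R]

/-- Semantics of `powT`. [folklore] -/
@[simp] theorem realize_powT (v : Empty ⊕ Fin k → R) (t : Language.orderedRing.Term (Empty ⊕ Fin k)) :
    ∀ j : ℕ, (powT t j).realize v = t.realize v ^ j
  | 0 => by simp [powT]
  | j + 1 => by simp [powT, realize_powT v t j, pow_succ]

/-- Semantics of `sumT`. [folklore] -/
@[simp] theorem realize_sumT (v : Empty ⊕ Fin k → R) :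
    ∀ ts : List (Language.orderedRing.Term (Empty ⊕ Fin k)),
      (sumT ts).realize v = (ts.map (Term.realize v)).sum
  | [] => by simp [sumT]
  | t :: ts => by simp [sumT, realize_sumT v ts]

/-- The explicit term `genericMonicPolyTerm n` denotes Mathlib's `genericMonicPoly n`: its value at
`v` is `FreeCommRing.lift (v ∘ Sum.inr) (genericMonicPoly n)`. [folklore] -/
theorem realize_genericMonicPolyTerm (n : ℕ) (v : Empty ⊕ Fin (n + 1) → R) :
    (genericMonicPolyTerm n).realize v =
      FreeCommRing.lift (v ∘ Sum.inr) (FirstOrder.Field.genericMonicPoly n) := by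
  simp [genericMonicPolyTerm, FirstOrder.Field.genericMonicPoly, List.sum_ofFn, Function.comp_def]

/-- **Semantics of `sentence n`** in a non-trivial commutative ring: every monic polynomial of
degree `n` has a root (the statement of Mathlib's `Field.realize_genericMonicPolyHasRoot`, with
the same proof through `Field.lift_genericMonicPoly`). [folklore] -/
theorem realize_sentence [Nontrivial R] (n : ℕ) :
    R ⊨ sentence n ↔ ∀ p : { p : R[X] // p.Monic ∧ p.natDegree = n }, ∃ x, p.1.eval x = 0 := by
  rw [Equiv.forall_congr_left ((monicEquivDegreeLT n).trans (degreeLTEquiv R n).toEquiv)]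
  simp [Sentence.Realize, sentence, realize_genericMonicPolyTerm,
    FirstOrder.Field.lift_genericMonicPoly]

end Semantics

/-- In a model of the theory of ordered fields, the explicit sentence `sentence (2 n + 1)` and the
axiom `oddDegreeHasRootSentence n` of `Theory.RCF` are equivalent (both say that every monic
polynomial of degree `2 n + 1` over the field `OrderedFieldModel.Dom M` has a root). [folklore] -/
theorem realize_sentence_iff_oddDegree {M : Type w} [Language.orderedRing.Structure M]
    [M ⊨ Theory.orderedField] (n : ℕ) :
    M ⊨ sentence (2 * n + 1) ↔ M ⊨ oddDegreeHasRootSentence n :=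
  (OrderedFieldModel.realize_iff (M := M) (sentence (2 * n + 1))).symm.trans <|
    (realize_sentence (R := OrderedFieldModel.Dom M) (2 * n + 1)).trans <|
      (realize_oddDegreeHasRootSentence (OrderedFieldModel.Dom M) n).symm.trans
        (OrderedFieldModel.realize_iff (M := M) (oddDegreeHasRootSentence n))

/-! ### Gödel numbers of the explicit axioms -/

/-- Letters of `powT x j` from the letters `xl` of `x`. [folklore] -/
def lettersPow (xl : List ℕ) : ℕ → List ℕ
  | 0 => [9]
  | j + 1 => 3 :: (lettersPow xl j ++ xl)

/-- Letters of `sumT` from the letters of the summands. [folklore] -/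
def lettersSum : List (List ℕ) → List ℕ
  | [] => [7]
  | l :: ls => 1 :: (l ++ lettersSum ls)

/-- Letters of the monomial `&i * &n ^ i`. [folklore] -/
def lettersMono (n i : ℕ) : List ℕ := 3 :: (4 * i + 2) :: lettersPow [4 * n + 2] i

/-- Letters of `genericMonicPolyTerm n`. [folklore] -/
def lettersPoly (n : ℕ) : List ℕ := 1 :: (lettersPow [4 * n + 2] n ++ lettersSum ((List.range n).map (lettersMono n)))

/-- Letters of `sentence n`: `n` letters `7` (the `∀`s), then the letters of
`∃ = ¬ ∀ ¬` around the equation. [folklore] -/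
def lettersSentence (n : ℕ) : List ℕ :=
  List.replicate n 7 ++ (3 :: 7 :: 3 ::
    ([2 * Nat.pair (n + 1) (encode (lettersPoly n)), 2 * Nat.pair (n + 1) (encode [7])] ++
      [4 * n + 15, 4 * n + 11]))

open Literature.ModelTheory.ProofTheory.PreFOL

/-- Letters of a bound variable of `Language.orderedRing`. [folklore] -/
theorem termLetters_var' (i : Fin k) :
    termLetters (Term.var (Sum.inr i) : Language.orderedRing.Term (Empty ⊕ Fin k)) = [4 * i.val + 2] :=
  termLetters_var i

/-- Letters of the term `1` of `Language.orderedRing`. [folklore] -/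
theorem termLetters_one' : termLetters (1 : Language.orderedRing.Term (Empty ⊕ Fin k)) = [9] := by
  show termLetters (Term.func _ _) = _
  rw [termLetters_func]; rfl

/-- Letters of the term `0` of `Language.orderedRing`. [folklore] -/
theorem termLetters_zero' : termLetters (0 : Language.orderedRing.Term (Empty ⊕ Fin k)) = [7] := by
  show termLetters (Term.func _ _) = _
  rw [termLetters_func]; rfl

/-- Letters of a product of terms of `Language.orderedRing`. [folklore] -/
theorem termLetters_mul' (t₁ t₂ : Language.orderedRing.Term (Empty ⊕ Fin k)) :
    termLetters (t₁ * t₂) = 3 :: (termLetters t₁ ++ termLetters t₂) := by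
  show termLetters (Term.func _ ![t₁, t₂]) = _
  rw [termLetters_func]; simp [List.ofFn_succ]; rfl

/-- Letters of a sum of terms of `Language.orderedRing`. [folklore] -/
theorem termLetters_add' (t₁ t₂ : Language.orderedRing.Term (Empty ⊕ Fin k)) :
    termLetters (t₁ + t₂) = 1 :: (termLetters t₁ ++ termLetters t₂) := by
  show termLetters (Term.func _ ![t₁, t₂]) = _
  rw [termLetters_func]; simp [List.ofFn_succ]; rfl

/-- Letters of `powT`. [folklore] -/
theorem termLetters_powT (t : Language.orderedRing.Term (Empty ⊕ Fin k)) :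
    ∀ j : ℕ, termLetters (powT t j) = lettersPow (termLetters t) j
  | 0 => by simp [powT, lettersPow, termLetters_one']
  | j + 1 => by simp [powT, lettersPow, termLetters_mul', termLetters_powT t j]

/-- Letters of `sumT`. [folklore] -/
theorem termLetters_sumT : ∀ ts : List (Language.orderedRing.Term (Empty ⊕ Fin k)),
    termLetters (sumT ts) = lettersSum (ts.map termLetters)
  | [] => by simp [sumT, lettersSum, termLetters_zero']
  | t :: ts => by simp [sumT, lettersSum, termLetters_add', termLetters_sumT ts]

/-- Letters of `genericMonicPolyTerm n`. [folklore] -/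
theorem termLetters_genericMonicPolyTerm (n : ℕ) :
    termLetters (genericMonicPolyTerm n) = lettersPoly n := by
  have hmono : ∀ i : Fin n,
      termLetters (Term.var (Sum.inr i.castSucc) * powT (Term.var (Sum.inr (Fin.last n))) i :
        Language.orderedRing.Term (Empty ⊕ Fin (n + 1))) = lettersMono n i := fun i => by
    simp [lettersMono, termLetters_mul', termLetters_powT]
  simp only [genericMonicPolyTerm, termLetters_add', termLetters_powT, termLetters_var',
    Fin.val_last, termLetters_sumT, List.map_ofFn, lettersPoly]
  congr 2
  rw [List.ofFn_eq_map, ← List.map_coe_finRange_eq_range, List.map_map]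
  exact congrArg lettersSum (List.map_congr_left fun i _ => hmono i)

/-- Letters of a universal closure: one letter `7` per quantifier. [folklore] -/
theorem formulaLetters_alls' : ∀ {n : ℕ} (φ : Language.orderedRing.BoundedFormula Empty n),
    formulaLetters φ.alls = List.replicate n 7 ++ formulaLetters φ
  | 0, _ => rfl
  | n + 1, φ => by
    rw [show φ.alls = φ.all.alls from rfl, formulaLetters_alls' φ.all, formulaLetters_all,
      List.replicate_succ']
    simp

/-- **The Gödel number of `sentence n`** is the code of the explicit letter string `lettersSentence n`.
[folklore] -/
theorem godelNumber_sentence (n : ℕ) : (sentence n).godelNumber = encode (lettersSentence n) := by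
  rw [godelNumber_eq, sentence, formulaLetters_alls']
  congr 1
  rw [show (∃' (genericMonicPolyTerm n =' 0) : Language.orderedRing.BoundedFormula Empty n) =
      ((genericMonicPolyTerm n =' 0).not.all).not from rfl]
  simp only [BoundedFormula.not, formulaLetters_imp, formulaLetters_all, Term.bdEqual,
    formulaLetters_equal, encode_term_eq, termLetters_genericMonicPolyTerm, termLetters_zero',
    lettersSentence, show (⊥ : Language.orderedRing.BoundedFormula Empty (n + 1)) = BoundedFormula.falsum
      from rfl, show (⊥ : Language.orderedRing.BoundedFormula Empty n) = BoundedFormula.falsum from rfl,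
    formulaLetters_falsum]
  simp; omega

/-! ### Primitive recursiveness of the codes -/

/-- `lettersPow` as an iteration. [folklore] -/
theorem lettersPow_eq_iterate (xl : List ℕ) (j : ℕ) : lettersPow xl j = (fun l => 3 :: (l ++ xl))^[j] [9] := by
  induction j with
  | zero => rfl
  | succ j ih => rw [Function.iterate_succ_apply', ← ih]; rfl

/-- `lettersPow` is primitive recursive. [folklore] -/
theorem primrec_lettersPow : Primrec₂ lettersPow := by
  have h : Primrec fun p : List ℕ × ℕ => (fun l => 3 :: (l ++ p.1))^[p.2] [9] :=
    Primrec.nat_iterate Primrec.snd (Primrec.const _)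
      (Primrec.list_cons.comp (Primrec.const 3)
        (Primrec.list_append.comp Primrec.snd (Primrec.fst.comp Primrec.fst))).to₂
  exact (h.of_eq fun p => (lettersPow_eq_iterate p.1 p.2).symm).to₂

/-- `lettersSum` as a right fold. [folklore] -/
theorem lettersSum_eq_foldr (ls : List (List ℕ)) : lettersSum ls = ls.foldr (fun l r => 1 :: (l ++ r)) [7] := by
  induction ls with
  | nil => rfl
  | cons l ls ih => simp [lettersSum, ih]

/-- `lettersSum` is primitive recursive. [folklore] -/
theorem primrec_lettersSum : Primrec lettersSum :=
  (Primrec.list_foldr Primrec.id (Primrec.const _)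
    (Primrec.list_cons.comp (Primrec.const 1) (Primrec.list_append.comp (Primrec.fst.comp Primrec.snd)
      (Primrec.snd.comp Primrec.snd))).to₂).of_eq fun ls => (lettersSum_eq_foldr ls).symm

/-- The letter `4 m + 2` of the variable `&m`, primitive recursively in `m`. [folklore] -/
theorem primrec_varLetter : Primrec fun m : ℕ => 4 * m + 2 :=
  Primrec.nat_add.comp (Primrec.nat_mul.comp (Primrec.const 4) Primrec.id) (Primrec.const 2)

/-- `lettersMono` is primitive recursive. [folklore] -/
theorem primrec_lettersMono : Primrec₂ lettersMono := by
  have h : Primrec fun p : ℕ × ℕ => 3 :: (4 * p.2 + 2) :: lettersPow [4 * p.1 + 2] p.2 :=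
    Primrec.list_cons.comp (Primrec.const 3)
      (Primrec.list_cons.comp (primrec_varLetter.comp Primrec.snd)
        (primrec_lettersPow.comp (Primrec.list_cons.comp (primrec_varLetter.comp Primrec.fst)
          (Primrec.const [])) Primrec.snd))
  exact h.to₂

/-- `lettersPoly` is primitive recursive. [folklore] -/
theorem primrec_lettersPoly : Primrec lettersPoly :=
  Primrec.list_cons.comp (Primrec.const 1)
    (Primrec.list_append.comp
      (primrec_lettersPow.comp (Primrec.list_cons.comp primrec_varLetter (Primrec.const [])) Primrec.id)
      (primrec_lettersSum.comp (Primrec.list_map Primrec.list_range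
        (primrec_lettersMono.comp Primrec.fst Primrec.snd).to₂)))

/-- `List.replicate n 7` as an iteration. [folklore] -/
theorem replicate_eq_iterate (n : ℕ) : List.replicate n 7 = (List.cons 7)^[n] [] := by
  induction n with
  | zero => rfl
  | succ n ih => rw [Function.iterate_succ_apply', ← ih, List.replicate_succ]

/-- `lettersSentence` is primitive recursive. [folklore] -/
theorem primrec_lettersSentence : Primrec lettersSentence := by
  have hrep : Primrec fun n : ℕ => List.replicate n 7 :=
    (Primrec.nat_iterate Primrec.id (Primrec.const [])
      (Primrec.list_cons.comp (Primrec.const 7) Primrec.snd).to₂).of_eq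
      fun n => (replicate_eq_iterate n).symm
  have hp1 : Primrec fun n : ℕ => 2 * Nat.pair (n + 1) (encode (lettersPoly n)) :=
    Primrec.nat_mul.comp (Primrec.const 2)
      (Primrec₂.natPair.comp Primrec.succ (Primrec.encode.comp primrec_lettersPoly))
  have hp2 : Primrec fun n : ℕ => 2 * Nat.pair (n + 1) (encode [7]) :=
    Primrec.nat_mul.comp (Primrec.const 2) (Primrec₂.natPair.comp Primrec.succ (Primrec.const _))
  have h15 : Primrec fun n : ℕ => 4 * n + 15 :=
    Primrec.nat_add.comp (Primrec.nat_mul.comp (Primrec.const 4) Primrec.id) (Primrec.const 15)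
  have h11 : Primrec fun n : ℕ => 4 * n + 11 :=
    Primrec.nat_add.comp (Primrec.nat_mul.comp (Primrec.const 4) Primrec.id) (Primrec.const 11)
  have hnil : Primrec fun _ : ℕ => ([] : List ℕ) := Primrec.const _
  refine Primrec.list_append.comp hrep ?_
  refine Primrec.list_cons.comp (Primrec.const 3) (Primrec.list_cons.comp (Primrec.const 7)
    (Primrec.list_cons.comp (Primrec.const 3) ?_))
  exact Primrec.list_append.comp
    (Primrec.list_cons.comp hp1 (Primrec.list_cons.comp hp2 hnil))
    (Primrec.list_cons.comp h15 (Primrec.list_cons.comp h11 hnil))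

/-- **The Gödel number of `sentence n` is a primitive recursive function of `n`.** [folklore] -/
theorem primrec_godelNumber_sentence : Primrec fun n : ℕ => (sentence n).godelNumber :=
  (Primrec.encode.comp primrec_lettersSentence).of_eq fun n => (godelNumber_sentence n).symm

/-- The Gödel number of `sentence n` dominates `n`. [folklore] -/
theorem le_godelNumber_sentence (n : ℕ) : n ≤ (sentence n).godelNumber := by
  rw [godelNumber_sentence]
  refine le_trans ?_ (Encodable.length_le_encode _)
  simp [lettersSentence]

end MonicPolyHasRoot

/-! ### A recursive axiomatization of `RCF` -/

/-- The explicit axiom set `RCF'`: ordered fields in which non-negative elements are squares and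
the explicit sentences "every monic polynomial of degree `2 n + 1` has a root"
(`MonicPolyHasRoot.sentence (2 n + 1)`); it has the same consequences as `Theory.RCF`
(`models_RCF'_iff`) and is recursive (`RCF'_isRecursive`) (Marker 2002, §3.3: the axioms of
`RCF`). [cite: Marker2002, §3.3] -/
def Theory.RCF' : Language.orderedRing.Theory :=
  Theory.orderedField ∪ {nonnegHasSqrtSentence} ∪
    Set.range fun n : ℕ => MonicPolyHasRoot.sentence (2 * n + 1)

/-- `Theory.orderedField ⊆ Theory.RCF'`. [folklore] -/
theorem Theory.orderedField_subset_RCF' : Theory.orderedField ⊆ Theory.RCF' :=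
  Set.subset_union_left.trans Set.subset_union_left

/-- Every axiom of `RCF'` is a consequence of `RCF`. [folklore] -/
theorem RCF_models_of_mem_RCF' {ψ : Language.orderedRing.Sentence} (hψ : ψ ∈ Theory.RCF') :
    Theory.RCF ⊨ᵇ ψ := by
  rcases hψ with (hψ | hψ) | ⟨n, rfl⟩
  · exact Language.Theory.models_sentence_of_mem (Theory.orderedField_subset_RCF hψ)
  · rw [Set.mem_singleton_iff.1 hψ]
    exact Language.Theory.models_sentence_of_mem (Set.mem_union_right _ (Set.mem_singleton _))
  · refine Language.Theory.models_sentence_iff.2 fun M => ?_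
    exact (MonicPolyHasRoot.realize_sentence_iff_oddDegree n).2
      (Language.Theory.realize_sentence_of_mem Theory.RCF
        (Set.mem_union_left _ (Set.mem_union_right _ (Set.mem_range_self n))))

/-- Every axiom of `RCF` is a consequence of `RCF'`. [folklore] -/
theorem RCF'_models_of_mem_RCF {φ : Language.orderedRing.Sentence} (hφ : φ ∈ Theory.RCF) :
    Theory.RCF' ⊨ᵇ φ := by
  rcases hφ with (hφ | ⟨n, rfl⟩) | hφ
  · exact Language.Theory.models_sentence_of_mem (Theory.orderedField_subset_RCF' hφ)
  · refine Language.Theory.models_sentence_iff.2 fun M => ?_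
    haveI : M ⊨ Theory.orderedField :=
      Language.Theory.Model.mono M.is_model Theory.orderedField_subset_RCF'
    exact (MonicPolyHasRoot.realize_sentence_iff_oddDegree n).1
      (Language.Theory.realize_sentence_of_mem Theory.RCF'
        (Set.mem_union_right _ (Set.mem_range_self n)))
  · rw [Set.mem_singleton_iff.1 hφ]
    exact Language.Theory.models_sentence_of_mem
      (Set.mem_union_left _ (Set.mem_union_right _ (Set.mem_singleton _)))

/-- **`RCF'` and `RCF` have the same consequences.** [folklore] -/
theorem models_RCF'_iff (φ : Language.orderedRing.Sentence) : Theory.RCF' ⊨ᵇ φ ↔ Theory.RCF ⊨ᵇ φ :=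
  ⟨fun h => Language.Theory.models_of_models_theory (fun _ hψ => RCF_models_of_mem_RCF' hψ) h,
    fun h => Language.Theory.models_of_models_theory (fun _ hψ => RCF'_models_of_mem_RCF hψ) h⟩

open FirstOrder.Field in
/-- Mathlib's theory of fields is a finite set of sentences. [folklore] -/
theorem field_finite : (Language.Theory.field : Language.ring.Theory).Finite := by
  have : (Set.univ : Set FieldAxiom).Finite := by
    have h : (Set.univ : Set FieldAxiom) = {FieldAxiom.addAssoc, .zeroAdd, .negAddCancel, .mulAssoc,
        .mulComm, .oneMul, .existsInv, .leftDistrib, .existsPairNE} := by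
      ext a; cases a <;> simp
    rw [h]
    exact Set.toFinite _
  simpa [Language.Theory.field, ← Set.image_univ] using this.image FieldAxiom.toSentence

/-- `Theory.orderedField` is a finite set of sentences. [folklore] -/
theorem orderedField_finite : Theory.orderedField.Finite := by
  refine ((field_finite.image _).union ?_).union (Set.toFinite _)
  exact (((Set.finite_singleton _).insert _).insert _).insert _

/-- Primitive recursive predicates are computable predicates. [folklore] -/
theorem computablePred_of_primrecPred {p : ℕ → Prop} (hp : PrimrecPred p) : ComputablePred p := by
  obtain ⟨d, h⟩ := hp
  exact ⟨d, h.to_comp⟩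

/-- The range of a primitive recursive function dominating the identity is a computable set
(bounded search). [folklore] -/
theorem computablePred_mem_range_of_le {g : ℕ → ℕ} (hg : Primrec g) (hle : ∀ n, n ≤ g n) :
    ComputablePred fun m : ℕ => ∃ n, g n = m := by
  have hR : PrimrecRel fun n m : ℕ => g n = m :=
    Primrec.eq.comp (hg.comp Primrec.fst) Primrec.snd
  have h : PrimrecPred fun m : ℕ => ∃ n < m + 1, g n = m :=
    hR.exists_lt.comp Primrec.succ Primrec.id
  refine computablePred_of_primrecPred (h.of_eq fun m => ⟨?_, ?_⟩)
  · rintro ⟨n, -, hn⟩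
    exact ⟨n, hn⟩
  · rintro ⟨n, rfl⟩
    exact ⟨n, Nat.lt_succ_of_le (hle n), rfl⟩

/-- **`RCF'` is a recursive set of axioms**: a finite set together with the range of the
primitive recursive, identity-dominating code function `n ↦ ⌜sentence (2 n + 1)⌝`. [folklore] -/
theorem RCF'_isRecursive : Theory.RCF'.IsRecursive := by
  have hfin : (Theory.orderedField ∪ {nonnegHasSqrtSentence}).Finite :=
    orderedField_finite.union (Set.finite_singleton _)
  have h1 := Language.Theory.IsRecursive.of_finite hfin
  have hg : Primrec fun n : ℕ => (MonicPolyHasRoot.sentence (2 * n + 1)).godelNumber :=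
    MonicPolyHasRoot.primrec_godelNumber_sentence.comp
      (Primrec.succ.comp (Primrec.nat_mul.comp (Primrec.const 2) Primrec.id))
  have h2 := computablePred_mem_range_of_le hg fun n =>
    (show n ≤ 2 * n + 1 by omega).trans (MonicPolyHasRoot.le_godelNumber_sentence _)
  refine (computablePred_or h1 h2).of_eq fun m => ?_
  simp only [Theory.RCF', Set.mem_union, Set.mem_range]
  constructor
  · rintro (⟨φ, hφ, rfl⟩ | ⟨n, hn⟩)
    · exact ⟨φ, Or.inl hφ, rfl⟩
    · exact ⟨_, Or.inr ⟨n, rfl⟩, hn⟩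
  · rintro ⟨φ, hφ | ⟨n, rfl⟩, rfl⟩
    · exact Or.inl ⟨φ, hφ, rfl⟩
    · exact Or.inr ⟨n, rfl⟩

/-- **`RCF` is computably axiomatizable** (Marker 2002, §3.3 and proof of Cor. 3.3.16: "`RCF` is
recursively axiomatized"): the recursive set `RCF'` has the same consequences as `Theory.RCF`.
[cite: Marker2002, Cor. 3.3.16] -/
theorem RCF_isComputablyAxiomatizable : Theory.RCF.IsComputablyAxiomatizable :=
  ⟨Theory.RCF', RCF'_isRecursive, models_RCF'_iff⟩

/-- **The theorems of `RCF` are recursively enumerable** (enumerability theorem for the recursive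
axiomatization `RCF'`; Enderton 2001, §3.5 Thm. 35I). [folklore] -/
theorem RCF_isRE : Theory.RCF.IsRE :=
  Language.Theory.IsComputablyAxiomatizable.isRE_holds Language.orderedRing.isRecursivelyPresented
    RCF_isComputablyAxiomatizable

/-- **Tarski's decidability theorem from completeness** (Marker 2002, Cor. 3.3.16, whose proof is
exactly this: `RCF` is complete and recursively axiomatized, hence decidable by Lemma 2.2.8 =
Janiczak's theorem): the named fact `tarski_isDecidable` follows from the named fact
`tarski_isComplete`. [cite: Marker2002, Cor. 3.3.16] -/
theorem tarski_isDecidable_of_isComplete (h : tarski_isComplete) : tarski_isDecidable :=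
  Language.Theory.isDecidable_of_isComplete_of_isComputablyAxiomatizable_holds
    Language.orderedRing.isRecursivelyPresented h RCF_isComputablyAxiomatizable

/-! ### Completeness, hence decidability, from quantifier elimination -/

/-- The ordered-ring embedding `ℤ ↪ K` of the integers into an ordered field, as an embedding of
`Language.orderedRing`-structures (for the global structures of `Languages.lean`). [folklore] -/
def intEmbedding (K : Type*) [Field K] [LinearOrder K] [IsStrictOrderedRing K] :
    ℤ ↪[Language.orderedRing] K where
  toFun z := (z : K)
  inj' := Int.cast_injective
  map_fun' {n} f x := by
    cases f
    · exact Int.cast_add (x 0) (x 1)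
    · exact Int.cast_mul (x 0) (x 1)
    · exact Int.cast_neg (x 0)
    · exact Int.cast_zero
    · exact Int.cast_one
  map_rel' {n} r x := by
    cases r
    exact Int.cast_le

/-- **Quantifier-free sentences are absolute**: a quantifier-free formula of the language of
ordered rings without free variables has, in every ordered field, the truth value it has in `ℤ`
(its atoms compare the integer values of closed terms; Mathlib's
`BoundedFormula.IsQF.realize_embedding` along `intEmbedding`). [folklore] -/
theorem realize_iff_int_of_isQF {K : Type*} [Field K] [LinearOrder K] [IsStrictOrderedRing K]
    {ψ : Language.orderedRing.Formula (Fin 0)} (hψ : ψ.IsQF) :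
    ψ.Realize (default : Fin 0 → K) ↔ ψ.Realize (default : Fin 0 → ℤ) := by
  have h := hψ.realize_embedding (intEmbedding K) (v := (default : Fin 0 → ℤ))
    (xs := (default : Fin 0 → ℤ))
  simp only [Formula.Realize]
  convert h using 2

/-- In a model `M` of `RCF`, a sentence `φ` which is `RCF`-equivalent (after relabelling to
`Fin 0` free variables) to a quantifier-free formula `ψ` is true iff `ψ` is true in `ℤ`; in
particular its truth value does not depend on `M`. [folklore] -/
theorem realize_iff_int_of_iff_isQF {φ : Language.orderedRing.Sentence}
    {ψ : Language.orderedRing.Formula (Fin 0)} (hψ : ψ.IsQF)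
    (hiff : (φ.relabel Empty.elim : Language.orderedRing.Formula (Fin 0)) ⇔[Theory.RCF] ψ)
    (M : Type w) [Language.orderedRing.Structure M] [M ⊨ Theory.RCF] [Nonempty M] :
    M ⊨ φ ↔ ψ.Realize (default : Fin 0 → ℤ) := by
  rw [← OrderedFieldModel.realize_iff (M := M) φ,
    ← realize_iff_int_of_isQF (K := OrderedFieldModel.Dom M) hψ,
    ← hiff.realize_iff (M := OrderedFieldModel.Dom M), Formula.realize_relabel]
  exact iff_of_eq (congrArg (fun v : Empty → OrderedFieldModel.Dom M => Formula.Realize φ v)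
    (Subsingleton.elim _ _))

/-- **`RCF` is complete if it has quantifier elimination** (Marker 2002, proof of Cor. 3.3.16:
by QE every sentence is `RCF`-equivalent to a quantifier-free sentence, which is decided in the
prime ring `ℤ ⊆ ℚ` common to all real closed fields): the named fact `tarski_isComplete` follows
from the named fact `tarski_hasQE`. [cite: Marker2002, Cor. 3.3.16] -/
theorem tarski_isComplete_of_hasQE (h : tarski_hasQE) : tarski_isComplete := by
  haveI := real_model_RCF
  let MR : Language.Theory.ModelType.{0, 0, 0} Theory.RCF := Language.Theory.ModelType.of Theory.RCF ℝ
  refine ⟨⟨MR⟩, fun φ => ?_⟩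
  obtain ⟨ψ, hψ, hiff⟩ := h 0 (φ.relabel Empty.elim)
  have key : ∀ M : Language.Theory.ModelType.{0, 0, 0} Theory.RCF,
      M ⊨ φ ↔ ψ.Realize (default : Fin 0 → ℤ) := fun M =>
    realize_iff_int_of_iff_isQF hψ hiff M
  by_cases hR : MR ⊨ φ
  · exact Or.inl (Language.Theory.models_sentence_iff.2 fun M => (key M).2 ((key MR).1 hR))
  · refine Or.inr (Language.Theory.models_sentence_iff.2 fun M => ?_)
    rw [Sentence.realize_not]
    exact fun hM => hR ((key MR).2 ((key M).1 hM))

/-- **Tarski's decidability theorem from quantifier elimination**: the named fact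
`tarski_isDecidable` follows from the named fact `tarski_hasQE` (Marker 2002, Cor. 3.3.16:
quantifier elimination ⇒ completeness ⇒ decidability, `RCF` being recursively axiomatized).
[cite: Marker2002, Cor. 3.3.16] -/
theorem tarski_isDecidable_of_hasQE (h : tarski_hasQE) : tarski_isDecidable :=
  tarski_isDecidable_of_isComplete (tarski_isComplete_of_hasQE h)

/-! ### Discharge of `tarski_isDecidable` -/

/-- **Tarski's theorem: the theory `RCF` of real closed ordered fields is decidable** — discharge
of the named fact `tarski_isDecidable` of `RealExpField.lean` (**periods.S29**; Tarski 1951;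
Marker 2002, Cor. 3.3.16, with Marker's proof: `RCF` is complete (`tarski_isComplete_holds`,
`RealClosedTransfer.lean`) and recursively axiomatized (`RCF_isComputablyAxiomatizable`), hence
decidable by Janiczak's theorem, Marker Lemma 2.2.8
(`Language.Theory.isDecidable_of_isComplete_of_isComputablyAxiomatizable_holds`)).
[cite: Tarski1951, Cor. 3.3.16 of Marker2002 (decidability of RCF)] -/
theorem tarski_isDecidable_holds : tarski_isDecidable :=
  tarski_isDecidable_of_isComplete tarski_isComplete_holds

/-- **Tarski's decision method for elementary algebra** (Tarski 1951; Marker 2002, Cor. 3.3.16):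
the complete theory `Th(ℝ; +, *, -, 0, 1, ≤)` of the ordered field of real numbers is decidable —
by completeness of `RCF` (`tarski_isComplete_holds`) its members are exactly the consequences of
`RCF`, of which `ℝ` is a model (`real_model_RCF`).
[cite: Tarski1951, Cor. 3.3.16 of Marker2002 (decidability of RCF)] -/
theorem isDecidable_completeTheory_real :
    (Language.orderedRing.completeTheory ℝ).IsDecidable := by
  haveI : ℝ ⊨ Theory.RCF := real_model_RCF
  refine ComputablePred.of_eq tarski_isDecidable_holds fun n => exists_congr fun φ => ?_
  refine and_congr_left fun _ => ?_
  rw [← (Language.completeTheory.isMaximal Language.orderedRing ℝ).mem_iff_models,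
    Language.mem_completeTheory]
  exact (Language.Theory.IsComplete.realize_sentence_iff tarski_isComplete_holds φ ℝ).symm

end Literature.ModelTheory.ExponentialFields
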